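import Literature.Probability.LatticeModels.BadClusterTail
import Literature.Probability.Percolation.WindingTypes
import Literature.Probability.Percolation.SiteCrossingDuality
import HarnessLib

/-!
# No bad percolation from good paths of upper and lower winding type (GH2000, Lemma 5.5, last step)

Topic `Probability/LatticeModels`. The concluding paragraph of the proof of Georgii–Higuchi's
Lemma 5.5 (p. 16): "let `A_{x,y}` denote the event that there exists a `≤∗`path from `x` to `y`
above `Δ`, and `B_{x,y}` the event that such a path exists below `Δ` … `ν̂(A_{x,y} ∩ B_{x,y}) ≥
ν̂(A_{x,y}) ν̂(B_{x,y}) ≥ (θ/4)⁴` … if `A_{x,y} ∩ B_{x,y}` occurs then `Δ` is surrounded by a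
`≤∗`circuit … Letting `Δ ↑ ℤ²` we see that with probability at least `(θ/4)⁴` each finite set is
surrounded by a `≤∗`circuit. Since this event is measurable with respect to the product-tail on
which `ν̂` is trivial, the lemma follows."

Winding rendition (the paths produced by the pinning lemma may dip below/above the axis): the good
`∗`-walk "above `Δ = Λ_m`" is required to be of upper winding type (`UpperType`, `WindingTypes.lean`)
and the one "below" of lower type; by `exists_mem_support_of_types` no bad lattice cluster through
`Λ_m` is then infinite; as `m → ∞` these events decrease to "no infinite bad lattice cluster", whose
probability is `0` or `1` (`measure_existsInfBadCluster_eq_zero_or_one`).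

* `GoodAboveW`, `GoodBelowW` — the events `A_{x,y}`, `B_{x,y}` (inside a box `Λ_H`), measurable,
  increasing in `ω̂` and decreasing in `ω`;
* `badCluster_subset_box_of_goodW` — the deterministic step;
* **`ae_no_bad_percolation_of_goodW`** — if for every `m ≥ 1` some `A_{x,y}, B_{x,y}` have
  probabilities `≥ c₁, c₂ > 0` under `μ₁ ⊗ μ₂` (tail-trivial Gibbs measures), then almost surely
  there is no infinite lattice cluster of bad sites.

## References

* H.-O. Georgii, Y. Higuchi, J. Math. Phys. 41 (2000), proof of Lemma 5.5 (p. 16)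
  [GeorgiiHiguchi2000].
-/

noncomputable section

open MeasureTheory Filter Topology Finset SimpleGraph
open Literature.Probability.Percolation
open scoped ENNReal

namespace Literature.Probability.LatticeModels

/-! ### The band events -/

section Events

/-- `A_{x,y}`: a good `∗`-walk from `x` to `y` inside `Λ_H` of upper winding type around `Λ_m`
("above `Δ = Λ_m`"). [cite: GeorgiiHiguchi2000, Lemma 5.5 (proof, p. 16)] -/
def GoodAboveW (m H : ℕ) (x y : Site 2) (p : SpinConfig (Site 2) × SpinConfig (Site 2)) : Prop :=
  ∃ α : zdStarGraph.Walk x y, UpperType m α ∧ ∀ z ∈ α.support, z ∉ spinSites 1 (badConfig p) ∧ z ∈ box 2 H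

/-- `B_{x,y}`: a good `∗`-walk from `x` to `y` inside `Λ_H` of lower winding type ("below `Δ`"). [cite: GeorgiiHiguchi2000, Lemma 5.5 (proof, p. 16)] -/
def GoodBelowW (m H : ℕ) (x y : Site 2) (p : SpinConfig (Site 2) × SpinConfig (Site 2)) : Prop :=
  ∃ α : zdStarGraph.Walk x y, LowerType m α ∧ ∀ z ∈ α.support, z ∉ spinSites 1 (badConfig p) ∧ z ∈ box 2 H

/-- Good sites persist when `ω` decreases or `ω̂` increases. [folklore] -/
theorem not_mem_bad_mono {p q : SpinConfig (Site 2) × SpinConfig (Site 2)} {z : Site 2} (h1 : q.1 z ≤ p.1 z) (h2 : p.2 z ≤ q.2 z)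
    (h : z ∉ spinSites 1 (badConfig p)) : z ∉ spinSites 1 (badConfig q) := by
  rw [mem_spinSites_badConfig] at h ⊢
  rintro ⟨hq1, hq2⟩
  apply h
  constructor
  · exact intUnits_eq_one_of_one_le (hq1 ▸ h1)
  · rw [hq2] at h2
    rcases Int.units_eq_one_or (p.2 z) with h' | h'
    · rw [h'] at h2; exact absurd h2 (by decide)
    · exact h'

/-- Measurability of events "there is a walk with given ends, satisfying a deterministic condition,
all of whose vertices are good and satisfy a deterministic condition". [folklore] -/
theorem measurableSet_exists_goodWalk' (x y : Site 2) (Q : zdStarGraph.Walk x y → Prop) (P : Site 2 → Prop) :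
    MeasurableSet {p : SpinConfig (Site 2) × SpinConfig (Site 2) |
      ∃ α : zdStarGraph.Walk x y, Q α ∧ ∀ z ∈ α.support, z ∉ spinSites 1 (badConfig p) ∧ P z} := by
  classical
  have heq : {p : SpinConfig (Site 2) × SpinConfig (Site 2) | ∃ α : zdStarGraph.Walk x y, Q α ∧ ∀ z ∈ α.support, z ∉ spinSites 1 (badConfig p) ∧ P z} =
      ⋃ l : List (Site 2), ⋃ (_ : ∃ α : zdStarGraph.Walk x y, Q α ∧ α.support = l ∧ ∀ z ∈ l, P z),
        ⋂ z ∈ l, {p | z ∉ spinSites 1 (badConfig p)} := by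
    ext p
    simp only [Set.mem_setOf_eq, Set.mem_iUnion, Set.mem_iInter, exists_prop]
    constructor
    · rintro ⟨α, hQ, hα⟩
      exact ⟨α.support, ⟨α, hQ, rfl, fun z hz => (hα z hz).2⟩, fun z hz => (hα z hz).1⟩
    · rintro ⟨l, ⟨α, hQ, rfl, hP⟩, hgood⟩
      exact ⟨α, hQ, fun z hz => ⟨hgood z hz, hP z hz⟩⟩
  rw [heq]
  refine MeasurableSet.iUnion fun l => MeasurableSet.iUnion fun _ =>
    MeasurableSet.biInter (Set.Finite.countable (List.finite_toSet l)) fun z _ => ?_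
  have : {p : SpinConfig (Site 2) × SpinConfig (Site 2) | z ∉ spinSites 1 (badConfig p)} =
      {p | p.1 z = 1 ∧ p.2 z = -1}ᶜ := by
    ext p; simp only [Set.mem_setOf_eq, Set.mem_compl_iff, mem_spinSites_badConfig]
  rw [this]
  exact ((measurableSet_eq_fun ((measurable_pi_apply z).comp measurable_fst) measurable_const).inter
    (measurableSet_eq_fun ((measurable_pi_apply z).comp measurable_snd) measurable_const)).compl

/-- `A_{x,y}` is measurable. [folklore] -/
theorem measurableSet_goodAboveW (m H : ℕ) (x y : Site 2) :
    MeasurableSet {p : SpinConfig (Site 2) × SpinConfig (Site 2) | GoodAboveW m H x y p} :=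
  measurableSet_exists_goodWalk' x y _ _

/-- `B_{x,y}` is measurable. [folklore] -/
theorem measurableSet_goodBelowW (m H : ℕ) (x y : Site 2) :
    MeasurableSet {p : SpinConfig (Site 2) × SpinConfig (Site 2) | GoodBelowW m H x y p} :=
  measurableSet_exists_goodWalk' x y _ _

/-- `A_{x,y}` is decreasing in `ω`. [cite: GeorgiiHiguchi2000, Lemma 5.5 (proof: "increasing functions of ω̂ − ω")] -/
theorem goodAboveW_anti_left {m H : ℕ} {x y : Site 2} (ω ω₁ ω' : SpinConfig (Site 2)) (h : ω₁ ≤ ω)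
    (hA : GoodAboveW m H x y (ω, ω')) : GoodAboveW m H x y (ω₁, ω') := by
  obtain ⟨α, hU, hα⟩ := hA
  exact ⟨α, hU, fun z hz => ⟨not_mem_bad_mono (p := (ω, ω')) (h z) le_rfl (hα z hz).1, (hα z hz).2⟩⟩

/-- `A_{x,y}` is increasing in `ω̂`. [cite: GeorgiiHiguchi2000, Lemma 5.5 (proof)] -/
theorem goodAboveW_mono_right {m H : ℕ} {x y : Site 2} (ω ω' ω₂' : SpinConfig (Site 2)) (h : ω' ≤ ω₂')
    (hA : GoodAboveW m H x y (ω, ω')) : GoodAboveW m H x y (ω, ω₂') := by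
  obtain ⟨α, hU, hα⟩ := hA
  exact ⟨α, hU, fun z hz => ⟨not_mem_bad_mono (p := (ω, ω')) le_rfl (h z) (hα z hz).1, (hα z hz).2⟩⟩

/-- `B_{x,y}` is decreasing in `ω`. [cite: GeorgiiHiguchi2000, Lemma 5.5 (proof)] -/
theorem goodBelowW_anti_left {m H : ℕ} {x y : Site 2} (ω ω₁ ω' : SpinConfig (Site 2)) (h : ω₁ ≤ ω)
    (hB : GoodBelowW m H x y (ω, ω')) : GoodBelowW m H x y (ω₁, ω') := by
  obtain ⟨α, hL, hα⟩ := hB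
  exact ⟨α, hL, fun z hz => ⟨not_mem_bad_mono (p := (ω, ω')) (h z) le_rfl (hα z hz).1, (hα z hz).2⟩⟩

/-- `B_{x,y}` is increasing in `ω̂`. [cite: GeorgiiHiguchi2000, Lemma 5.5 (proof)] -/
theorem goodBelowW_mono_right {m H : ℕ} {x y : Site 2} (ω ω' ω₂' : SpinConfig (Site 2)) (h : ω' ≤ ω₂')
    (hB : GoodBelowW m H x y (ω, ω')) : GoodBelowW m H x y (ω, ω₂') := by
  obtain ⟨α, hL, hα⟩ := hB
  exact ⟨α, hL, fun z hz => ⟨not_mem_bad_mono (p := (ω, ω')) le_rfl (h z) (hα z hz).1, (hα z hz).2⟩⟩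

end Events

/-! ### The deterministic step: the winding pair confines the bad clusters of `Λ_m` -/

/-- **`A_{x,y} ∩ B_{x,y}` forces every bad lattice cluster through `Λ_m` to stay in `Λ_H`**
(`exists_mem_support_of_types` replaces "`Δ` is surrounded by a `≤∗`circuit"). [cite: GeorgiiHiguchi2000, Lemma 5.5 (proof, p. 16)] -/
theorem badCluster_subset_box_of_goodW {m H : ℕ} {x y : Site 2}
    {p : SpinConfig (Site 2) × SpinConfig (Site 2)} (hA : GoodAboveW m H x y p) (hB : GoodBelowW m H x y p)
    {t : Site 2} (ht : t ∈ box 2 m) : siteCluster (zdGraph 2) (spinSites 1 (badConfig p)) t ⊆ ↑(box 2 H) := by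
  obtain ⟨α, hαU, hα⟩ := hA
  obtain ⟨α', hα'L, hα'⟩ := hB
  rintro w ⟨htbad, hwbad, ⟨β⟩⟩
  by_contra hwH
  have hwH' : w ∉ box 2 H := fun h => hwH (Finset.mem_coe.2 h)
  obtain ⟨z, hzβ, hz⟩ := exists_mem_support_of_types α α' hαU hα'L (fun z hz => (hα z hz).2) (fun z hz => (hα' z hz).2)
    ht hwH' (β.mapLe (fun u v huv => ((siteOpenGraph_adj _ _ _ _).1 huv).1))
  rw [Walk.support_mapLe_eq_support] at hzβ
  have hzbad : z ∈ spinSites 1 (badConfig p) := support_subset_of_siteOpenGraph_walk β htbad z hzβ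
  rcases hz with hz | hz
  · exact (hα z hz).1 hzbad
  · exact (hα' z hz).1 hzbad

/-! ### The probabilistic assembly -/

section Assembly

variable {β : ℝ} {μ₁ μ₂ : Measure (SpinConfig (Site 2))}

/-- `{|C_bad(t)| = ∞}` is measurable in the pair. [folklore] -/
theorem measurableSet_badCluster_infinite (t : Site 2) :
    MeasurableSet {p : SpinConfig (Site 2) × SpinConfig (Site 2) | (siteCluster (zdGraph 2) (spinSites 1 (badConfig p)) t).Infinite} :=
  measurable_badConfig (measurable_spinSites 1 (measurableSet_sitePercolatesAt (G := zdGraph 2) t))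

/-- **No bad percolation from uniformly probable good paths of upper and lower type**
(Georgii–Higuchi 2000, proof of Lemma 5.5, last paragraph): for tail-trivial `μ₁, μ₂ ∈ 𝒢(β, 0)`, if
for every `m ≥ 1` there are sites `x, y` and a box `Λ_H` such that `A_{x,y}` and `B_{x,y}` have
`μ₁ ⊗ μ₂`-probabilities at least `c₁ > 0` and `c₂ > 0`, then `μ₁ ⊗ μ₂`-almost surely there is no
infinite lattice cluster of bad sites. [cite: GeorgiiHiguchi2000, Lemma 5.5 (proof, p. 16)] -/
theorem ae_no_bad_percolation_of_goodW (hβ : 0 ≤ β) (hμ₁ : μ₁ ∈ isingGibbsMeasures 2 β 0) (hμ₂ : μ₂ ∈ isingGibbsMeasures 2 β 0)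
    (hμ₁t : IsTailTrivial μ₁) (hμ₂t : IsTailTrivial μ₂) {c₁ c₂ : ℝ} (hc₁ : 0 < c₁) (hc₂ : 0 < c₂)
    (h : ∀ m : ℕ, 1 ≤ m → ∃ (H : ℕ) (x y : Site 2),
      c₁ ≤ (μ₁.prod μ₂).real {p | GoodAboveW m H x y p} ∧ c₂ ≤ (μ₁.prod μ₂).real {p | GoodBelowW m H x y p}) :
    ∀ᵐ p ∂(μ₁.prod μ₂), ∀ t, ¬ (siteCluster (zdGraph 2) (spinSites 1 (badConfig p)) t).Infinite := by
  have hG₁ : IsGibbsMeasure (isingSpecification (zdGraph 2) β 0) μ₁ := hμ₁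
  have hG₂ : IsGibbsMeasure (isingSpecification (zdGraph 2) β 0) μ₂ := hμ₂
  haveI := hG₁.isProbabilityMeasure
  haveI := hG₂.isProbabilityMeasure
  set ν := μ₁.prod μ₂ with hν
  -- the decreasing events `F_m = {no infinite bad cluster through Λ_m}`
  set F : ℕ → Set (SpinConfig (Site 2) × SpinConfig (Site 2)) := fun m =>
    {p | ∀ t ∈ box 2 m, ¬ (siteCluster (zdGraph 2) (spinSites 1 (badConfig p)) t).Infinite} with hF
  have hFm : ∀ m, MeasurableSet (F m) := fun m => by
    have : F m = ⋂ t ∈ (↑(box 2 m) : Set (Site 2)), {p | (siteCluster (zdGraph 2) (spinSites 1 (badConfig p)) t).Infinite}ᶜ := by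
      ext p; simp [hF]
    rw [this]
    exact MeasurableSet.biInter (Finset.countable_toSet _) fun t _ => (measurableSet_badCluster_infinite t).compl
  have hFanti : Antitone F := fun m m' hmm' p hp t ht => hp t (box_mono 2 hmm' ht)
  have hFinter : (⋂ m, F m) = {p | ∀ t, ¬ (siteCluster (zdGraph 2) (spinSites 1 (badConfig p)) t).Infinite} := by
    ext p
    simp only [Set.mem_iInter, Set.mem_setOf_eq, hF]
    constructor
    · intro hp t
      obtain ⟨M, hM⟩ := exists_forall_subset_box 2 ({t} : Finset (Site 2))
      exact hp M t (hM M le_rfl (Finset.mem_singleton_self t))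
    · exact fun hp m t _ => hp t
  -- `ν(F m) ≥ c₁ c₂` for `m ≥ 1`
  have hbound : ∀ m, 1 ≤ m → c₁ * c₂ ≤ ν.real (F m) := by
    intro m hm
    obtain ⟨H, x, y, hA, hB⟩ := h m hm
    have hAB := prod_measureReal_inter_ge hβ hμ₁ hμ₂ hμ₁t hμ₂t (measurableSet_goodAboveW m H x y) (measurableSet_goodBelowW m H x y)
      (fun ω ω₁ ω' hle hp => goodAboveW_anti_left ω ω₁ ω' hle hp) (fun ω ω' ω₂' hle hp => goodAboveW_mono_right ω ω' ω₂' hle hp)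
      (fun ω ω₁ ω' hle hp => goodBelowW_anti_left ω ω₁ ω' hle hp) (fun ω ω' ω₂' hle hp => goodBelowW_mono_right ω ω' ω₂' hle hp)
    have hsub : {p | GoodAboveW m H x y p} ∩ {p | GoodBelowW m H x y p} ⊆ F m := by
      rintro p ⟨hpA, hpB⟩ t ht hinf
      exact hinf ((Finset.finite_toSet (box 2 H)).subset (badCluster_subset_box_of_goodW hpA hpB ht))
    calc c₁ * c₂ ≤ ν.real {p | GoodAboveW m H x y p} * ν.real {p | GoodBelowW m H x y p} :=
          mul_le_mul hA hB hc₂.le measureReal_nonneg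
      _ ≤ ν.real ({p | GoodAboveW m H x y p} ∩ {p | GoodBelowW m H x y p}) := hAB
      _ ≤ ν.real (F m) := measureReal_mono hsub
  -- the limit
  have hlim : c₁ * c₂ ≤ ν.real (⋂ m, F m) := by
    have ht := tendsto_measure_iInter_atTop (μ := ν) (fun m => (hFm m).nullMeasurableSet) hFanti ⟨0, measure_ne_top ν _⟩
    have ht' : Tendsto (fun m => ν.real (F m)) atTop (𝓝 (ν.real (⋂ m, F m))) :=
      (ENNReal.tendsto_toReal (measure_ne_top ν _)).comp ht
    exact ge_of_tendsto ht' (Filter.eventually_atTop.2 ⟨1, hbound⟩)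
  refine ae_no_bad_percolation_of_measure_compl_ne_zero hμ₁t hμ₂t ?_
  rw [← hFinter]
  intro h0
  rw [measureReal_def, h0, ENNReal.toReal_zero] at hlim
  nlinarith

end Assembly

end Literature.Probability.LatticeModels
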